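import Literature.Probability.Percolation.SelfRefinementMeasure
import Literature.Probability.Percolation.KohlerSchindlerTassionRSW
import Summits.CriticalPhenomena.CardyFormulaZ2.Theorems.CardySelfRefinementCriticalPathRSWStubCone3Russo
import Summits.CriticalPhenomena.CardyFormulaZ2.Theorems.CardySelfRefinementCriticalPathRSWStubCone3GraphB

/-!
# Stub `stub_cone3` of line `finite-size-envelope` (crux `CriticalPathRSW`), part 19:
Russo's formula for the crossing probability along the line `s ↦ (ρ + s, c + C s)`

Support file for item `stmt-CriticalPhenomena-10267` (stub `stub_cone3`).  The crossing event of
the box `[-3n, 3n] × [-9n, 9n]`, pulled back to the coins of `M_3`, reads only the coins based in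
the square `[-9n, 9n]²` (`Cone3.determinedBy_crossing`); along the line `s ↦ (ρ + s, c + C s)`
through an interior point `(ρ, c) ∈ (0,1)²` every coin bias is differentiable at `s = 0` with
derivative `1` (selectors), `C` (own coins of interior labels) or `0` (`Cone3.hasDerivAt_coin`);
hence (`Cone3.hasDerivAt_crossing`, from the signed Russo formula of part 1)

`d/ds|₀ M_3(ρ + s, c + C s)(crossing) = Σ_{coins i} p'_i · (P(Â^{i←1}) - P(Â^{i←0}))`.

References: Grimmett 1999 §2.4 (Russo's formula); Beffara 2008 §5.
-/

noncomputable section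

namespace Summit.CriticalPhenomena.CardyFormulaZ2.Cruxes.CriticalPathRSW.FiniteSizeEnvelope

open Set MeasureTheory Filter Topology
open Literature.Probability.LatticeModels Literature.Probability.Percolation

namespace Cone3

variable {n : ℕ} {ρ c C : ℝ}

set_option quotPrecheck false

/-- Neighbours of `a` through an open label of `U`, inside `B`. -/
local notation "nbr⟪" B ", " U ", " a "⟫" =>
  {b : Site 2 | a ∈ B ∧ b ∈ B ∧ ∃ d : Fin 2,
    (b = a + Pi.single d 1 ∧ (a, d) ∈ U) ∨ (a = b + Pi.single d 1 ∧ (b, d) ∈ U)}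

/-- The open cluster of `a` inside `B`. -/
local notation "clus⟪" B ", " U ", " a "⟫" =>
  {b : Site 2 | Relation.ReflTransGen (fun x y : Site 2 => y ∈ nbr⟪B, U, x⟫) a b}

/-- The label configurations joining `L` to `R` inside `B`. -/
local notation "joined⟪" B ", " L ", " R "⟫" =>
  {U : Set (Site 2 × Fin 2) | ∃ a ∈ L, ∃ b ∈ R, b ∈ clus⟪B, U, a⟫}

/-- The pulled-back crossing event. -/
local notation "Â" => ((refinementConfig 3) ⁻¹' KST2023.crossing (3 * n) (3 * (3 * n)))

/-- The sites of the square `[-9n, 9n]²`. -/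
local notation "Kx" => (Fintype.piFinset fun _ : Fin 2 => Finset.Icc (-(9 * (n : ℤ))) (9 * (n : ℤ)))

/-- The coins based in the square. -/
local notation "Kc" => (Kx ×ˢ (Finset.univ : Finset (Fin 2)) ×ˢ (Finset.univ : Finset (Fin 3)))

/-- The coin biases along the line. -/
local notation "pL" => (fun s : ℝ => refinementParam 3 (ρ + s) (c + C * s))

/-- Their derivatives at `s = 0`. -/
local notation "pD" => (fun i : Site 2 × Fin 2 × Fin 3 =>
  if i.2.2 = 2 then (1 : ℝ) else if i.2.2 = 0 ∧ ¬ IsAxialEdge 3 (i.1, i.2.1) then C else 0)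

/-! ### The crossing event reads only the coins of the square -/

/-- Sites of the box are in the square. -/
theorem mem_Kx_of_mem_box {x : Site 2} (hx : x ∈ KST2023.box (3 * n) (3 * (3 * n))) : x ∈ Kx := by
  rw [KST2023.mem_box] at hx
  rw [Fintype.mem_piFinset, Fin.forall_fin_two, Finset.mem_Icc, Finset.mem_Icc]
  have h0 := abs_le.1 hx.1
  have h1 := abs_le.1 hx.2
  push_cast at h0 h1
  omega

/-- Coarse bases of labels based in the box are in the square. -/
theorem tupleBase_mem_Kx {ℓ : Site 2 × Fin 2} (hx : ℓ.1 ∈ KST2023.box (3 * n) (3 * (3 * n))) :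
    tupleBase 3 ℓ ∈ Kx := by
  rw [KST2023.mem_box] at hx
  rw [Fintype.mem_piFinset, Fin.forall_fin_two, Finset.mem_Icc, Finset.mem_Icc, tupleBase_apply, tupleBase_apply]
  have h0 := abs_le.1 ((Int.abs_ediv_le_abs (ℓ.1 0) ((3 : ℕ) : ℤ)).trans hx.1)
  have h1 := abs_le.1 ((Int.abs_ediv_le_abs (ℓ.1 1) ((3 : ℕ) : ℤ)).trans hx.2)
  push_cast at h0 h1 ⊢
  omega

/-- Coins based in the square are in `Kc`. -/
theorem mem_Kc {x : Site 2} (hx : x ∈ Kx) (e : Fin 2) (r : Fin 3) : (x, e, r) ∈ Kc := by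
  simp only [Finset.mem_product, Finset.mem_univ, and_true]
  exact hx

/-- **The pulled-back crossing event is determined by the coins of the square.** -/
theorem determinedBy_crossing : DeterminedBy Â (↑Kc : Set (Site 2 × Fin 2 × Fin 3)) := by
  rw [determinedBy_iff]
  intro S S' hSS'
  have hS : ∀ i ∈ (↑Kc : Set (Site 2 × Fin 2 × Fin 3)), (i ∈ S ↔ i ∈ S') := fun i hi =>
    ⟨fun h => ((Set.ext_iff.1 hSS' i).1 ⟨h, hi⟩).1, fun h => ((Set.ext_iff.1 hSS' i).2 ⟨h, hi⟩).1⟩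
  have key : ∀ ℓ : Site 2 × Fin 2, ℓ.1 ∈ KST2023.box (3 * n) (3 * (3 * n)) →
      (RefinementOpen 3 S ℓ ↔ RefinementOpen 3 S' ℓ) := by
    intro ℓ hℓ
    have h0 := hS _ (Finset.mem_coe.2 (mem_Kc (mem_Kx_of_mem_box hℓ) ℓ.2 0))
    have h1 := hS _ (Finset.mem_coe.2 (mem_Kc (tupleBase_mem_Kx hℓ) ℓ.2 1))
    have h2 := hS _ (Finset.mem_coe.2 (mem_Kc (tupleBase_mem_Kx hℓ) ℓ.2 2))
    unfold RefinementOpen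
    split_ifs
    · rw [h0, h1, h2]
    · rw [h0]
  simp only [Set.mem_preimage, refinementConfig_eq_edgeConfig, edgeConfig_mem_crossing_iff]
  exact joined_congr (fun ℓ hℓ => key ℓ hℓ.1)

/-- The pulled-back crossing event is measurable. -/
theorem measurableSet_crossing_preimage : MeasurableSet Â :=
  measurable_refinementConfig 3 (measurableSet_openCrossing_of_countable _ _ _)

/-! ### The coin biases along the line -/

/-- Near `s = 0` the clamp is inactive: `projIcc (a + k s) = a + k s` for `a ∈ (0, 1)`. -/
theorem eventually_coe_projIcc {a : ℝ} (k : ℝ) (ha0 : 0 < a) (ha1 : a < 1) :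
    ∀ᶠ s in nhds (0 : ℝ), ((Set.projIcc (0 : ℝ) 1 zero_le_one (a + k * s) : unitInterval) : ℝ) = a + k * s := by
  have hcont : Continuous fun s : ℝ => a + k * s := by fun_prop
  have hopen : IsOpen ((fun s : ℝ => a + k * s) ⁻¹' Set.Ioo 0 1) := hcont.isOpen_preimage _ isOpen_Ioo
  have hmem : (0 : ℝ) ∈ (fun s : ℝ => a + k * s) ⁻¹' Set.Ioo 0 1 := by simp [ha0, ha1]
  filter_upwards [hopen.mem_nhds hmem] with s hs
  rw [Set.projIcc_of_mem _ ⟨hs.1.le, hs.2.le⟩]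

/-- **The coin biases are differentiable at `s = 0`**, with derivative `pD`. -/
theorem hasDerivAt_coin (hρ0 : 0 < ρ) (hρ1 : ρ < 1) (hc0 : 0 < c) (hc1 : c < 1) (i : Site 2 × Fin 2 × Fin 3) :
    HasDerivAt (fun s : ℝ => ((pL s i : unitInterval) : ℝ)) (pD i) 0 := by
  obtain ⟨x, e, r⟩ := i
  fin_cases r
  · -- own coin
    by_cases hax : IsAxialEdge 3 (x, e)
    · have hval : (fun s : ℝ => ((pL s (x, e, 0) : unitInterval) : ℝ)) = fun _ => (1 / 2 : ℝ) := by
        funext s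
        have h := refinementParam_apply_zero_of_isAxialEdge (k := 3) (ρ + s) (c + C * s) hax
        simp only at h
        simp only [h, coe_half]
      show HasDerivAt (fun s : ℝ => ((pL s (x, e, 0) : unitInterval) : ℝ))
        (if (0 : Fin 3) = 2 then (1 : ℝ) else if (0 : Fin 3) = 0 ∧ ¬ IsAxialEdge 3 (x, e) then C else 0) 0
      rw [if_neg (by decide), if_neg (fun h => h.2 hax), hval]
      exact hasDerivAt_const _ _
    · have hval : ∀ s : ℝ, ((pL s (x, e, 0) : unitInterval) : ℝ) =
          ((Set.projIcc (0 : ℝ) 1 zero_le_one (c + C * s) : unitInterval) : ℝ) := by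
        intro s
        have h := refinementParam_apply_zero_of_not_isAxialEdge (k := 3) (ρ + s) (c + C * s) hax
        simp only at h
        simp only [h]
      show HasDerivAt (fun s : ℝ => ((pL s (x, e, 0) : unitInterval) : ℝ))
        (if (0 : Fin 3) = 2 then (1 : ℝ) else if (0 : Fin 3) = 0 ∧ ¬ IsAxialEdge 3 (x, e) then C else 0) 0
      rw [if_neg (by decide), if_pos ⟨rfl, hax⟩]
      have hlin : HasDerivAt (fun s : ℝ => c + C * s) C 0 := by
        simpa using ((hasDerivAt_id (0 : ℝ)).const_mul C).const_add c
      refine hlin.congr_of_eventuallyEq ?_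
      filter_upwards [eventually_coe_projIcc C hc0 hc1] with s hs
      rw [hval, hs]
  · -- shared coin
    have hval : (fun s : ℝ => ((pL s (x, e, 1) : unitInterval) : ℝ)) = fun _ => (1 / 2 : ℝ) := by
      funext s
      simp only [Fin.isValue, refinementParam_apply_one, coe_half]
    show HasDerivAt (fun s : ℝ => ((pL s (x, e, 1) : unitInterval) : ℝ))
      (if (1 : Fin 3) = 2 then (1 : ℝ) else if (1 : Fin 3) = 0 ∧ ¬ IsAxialEdge 3 (x, e) then C else 0) 0
    rw [if_neg (by decide), if_neg (fun h => absurd h.1 (by decide)), hval]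
    exact hasDerivAt_const _ _
  · -- selector
    have hval : ∀ s : ℝ, ((pL s (x, e, 2) : unitInterval) : ℝ) =
        ((Set.projIcc (0 : ℝ) 1 zero_le_one (ρ + 1 * s) : unitInterval) : ℝ) := by
      intro s
      simp only [refinementParam_apply_two, one_mul]
    show HasDerivAt (fun s : ℝ => ((pL s (x, e, 2) : unitInterval) : ℝ))
      (if (2 : Fin 3) = 2 then (1 : ℝ) else if (2 : Fin 3) = 0 ∧ ¬ IsAxialEdge 3 (x, e) then C else 0) 0
    rw [if_pos rfl]
    have hlin : HasDerivAt (fun s : ℝ => ρ + 1 * s) 1 0 := by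
      simpa using ((hasDerivAt_id (0 : ℝ)).const_mul (1 : ℝ)).const_add ρ
    refine hlin.congr_of_eventuallyEq ?_
    filter_upwards [eventually_coe_projIcc 1 hρ0 hρ1] with s hs
    rw [hval, hs]

/-! ### Russo's formula for the crossing probability -/

/-- **The derivative of the crossing probability along the line.** -/
theorem hasDerivAt_crossing (hρ0 : 0 < ρ) (hρ1 : ρ < 1) (hc0 : 0 < c) (hc1 : c < 1) :
    HasDerivAt (fun s : ℝ => (selfRefinementMeasure 3 (ρ + s) (c + C * s)).real (KST2023.crossing (3 * n) (3 * (3 * n))))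
      (∑ i ∈ Kc, pD i * ((prodBernoulli (refinementParam 3 ρ c)).real {S | insert i S ∈ Â} -
        (prodBernoulli (refinementParam 3 ρ c)).real {S | S \ {i} ∈ Â})) 0 := by
  classical
  have hcr : MeasurableSet (KST2023.crossing (3 * n) (3 * (3 * n))) := measurableSet_openCrossing_of_countable _ _ _
  have hfun : (fun s : ℝ => (selfRefinementMeasure 3 (ρ + s) (c + C * s)).real (KST2023.crossing (3 * n) (3 * (3 * n)))) =
      fun s : ℝ => (prodBernoulli (pL s)).real Â := by
    funext s
    exact selfRefinementMeasure_real_apply 3 _ _ hcr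
  rw [hfun]
  have h := hasDerivAt_prodBernoulli_real_signed (fun s : ℝ => refinementParam 3 (ρ + s) (c + C * s))
    (determinedBy_crossing (n := n)) 0 pD (fun i _ => hasDerivAt_coin hρ0 hρ1 hc0 hc1 i)
  simp only [add_zero, mul_zero] at h
  exact h

end Cone3

/-- **Registered sub-goal `stub_cone3_deriv` of stub `stub_cone3`** (`Cone3.hasDerivAt_crossing` with all local notations
expanded). -/
theorem stub_cone3_deriv : ∀ {n : ℕ} {ρ c C : ℝ} (hρ0 : 0 < ρ) (hρ1 : ρ < 1) (hc0 : 0 < c) (hc1 : c < 1), HasDerivAt (fun s : ℝ => (selfRefinementMeasure 3 (ρ + s) (c + C * s)).real (KST2023.crossing (3 * n) (3 * (3 * n)))) (∑ i ∈ ((((Fintype.piFinset fun _ : Fin 2 => Finset.Icc (-(9 * (n : ℤ))) (9 * (n : ℤ)))) ×ˢ (Finset.univ : Finset (Fin 2)) ×ˢ (Finset.univ : Finset (Fin 3)))), ((fun i : Site 2 × Fin 2 × Fin 3 => if i.2.2 = 2 then (1 : ℝ) else if i.2.2 = 0 ∧ ¬ IsAxialEdge 3 (i.1, i.2.1) then C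 else 0)) i * ((prodBernoulli (refinementParam 3 ρ c)).real {S | insert i S ∈ (((refinementConfig 3) ⁻¹' KST2023.crossing (3 * n) (3 * (3 * n))))} - (prodBernoulli (refinementParam 3 ρ c)).real {S | S \ {i} ∈ (((refinementConfig 3) ⁻¹' KST2023.crossing (3 * n) (3 * (3 * n))))})) 0 := by
  intro n ρ c C hρ0 hρ1 hc0 hc1
  exact Cone3.hasDerivAt_crossing hρ0 hρ1 hc0 hc1

end Summit.CriticalPhenomena.CardyFormulaZ2.Cruxes.CriticalPathRSW.FiniteSizeEnvelope

end
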